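import Summits.QuantumFields.YangMills.Theorems.BalabanUVNodesN16PinnedLooseMatch
import Summits.QuantumFields.YangMills.Theorems.BalabanUVNodesN16H7OfN07RecordSlot

/-!
# Route «BalabanUVNodes», crux K3⁷ `SpineGivenEndpointR13SepCoPH` (stmt-QuantumFields-20544), skeleton v5 941dddb108cbaacf — node N16 = NE3: THE N07 → N16 EDGE BY NAME AT
# NODE N07's RECORD SLOT.  v5's three N16 conjuncts `N16PinnedLoose 𝔯 ℓ₃ B ∧ N16LettersEnd N g ℓ₃ ∧ N16RadiusMatch ℓ₃ B` FROM node N05's `h5` AND node N07's K1-side leaf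
# of record `B11Leaf (Z11OfRecord F N ζ)` (the `h07` the K1⁷ consequent files read, `…N24K1OfOpenStubsV19ChildrenSplitByName`) MODULO the displayed (0.4)→(42) transfer
# `Thm1AtTransfer04to42 F N ζ B₀` (dag-n16-w1's `…N16H7OfN07RecordSlot`, the located averaging pin) — a cross-crux knit K1⁷ (N07) → K3⁷ (N16), count-neutral

Cell `pub-ymgap`, seat `pub-ymgap-dag-n16-e` (R134 acceleration seat (a), strategy s2 = BY-NAME KNIT at the record; HUMAN RULING D-0062; chair R424 venue), generation 16,
module 46 (THEOREMS ONLY, 0 `def`, 0 `sorry`, standard axioms).  `--kind proof --supports stmt-QuantumFields-20544 --as helper` (count-neutral; proves NO registered stub).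
`bears_on: R4∕N16 · edges N05 → N16, N07 → N16 (N07 at its RECORD SLOT) · out-edge N16 → N19 ∕ N21`.  Over module 45 `…N16PinnedLooseMatch` (p604267: the v5 producer
from `h5` ∧ `Thm1At (torusVP …)`), dag-n16-w1's file 3 `…N16H7OfN07RecordSlot` (p588364: `lipGauge`, `radiiMono_lipGauge'`, `interface_lipGauge'`, `Thm1AtTransfer04to42`) and
NODE 00's `Node00.exists_thm1At_of_b11Leaf_Z11OfRecord` (`Node00/CarriersZ`) — CITED BY NAME, none edited.

THE POINT.  Module 45 produces v5's N16 conjuncts from `h5` and leaf-06's Theorem-1 reading `∀ k, Thm1At (C F) (torusVP 4 F.L Nper (G F) (k+1))` with a free gauge shape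
`G F` and its two interface binders.  Node N07's statement OF RECORD is not that reading but its K1-side slot `B11Leaf (Z11OfRecord F N ζ)` — [Balaban1985Variational] Thm 1
typed at NODE 00's (0.4)-objects over print's whole family index (`Node00.exists_thm1At_of_b11Leaf_Z11OfRecord : B11Leaf (Z11OfRecord F N ζ) → ∃ C, ∀ i, Thm1At C (varProblemT
F N i.K i.k (ζ.R i))`).  The passage (0.4) → (42) (the tree's NE3 constraint is [B7]'s (42)-average, print's Thm 1 is stated for (0.4); LOCATED by this lineage and dag-n16-w3 as the
«averaging pin») is dag-n16-w1's ONE displayed hypothesis `Thm1AtTransfer04to42 F N ζ B₀ := (∃ C, ∀ i, Thm1At C (varProblemT …)) → ∃ C', C'.B₃ ≤ B₀ ∧ (M-bound) ∧ ∀ k,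
Thm1At C' (torusVP 4 F.L Nper (lipGauge 4 (Fin N)) (k+1))`.  So at `G := lipGauge` (interface by `radiiMono_lipGauge'` ∕ `interface_lipGauge'`) module 45 applies VERBATIM:
★ `exists_letters_n16HolderAtReading_loose_of_h5_b11Leaf_transfer_match` — v5's three N16 conjuncts ⟸ `h5` ∧ (∀ F, ∃ ζ B₀, B11Leaf (Z11OfRecord F N ζ) ∧ Thm1AtTransfer04to42
F N ζ B₀) ∧ `g F > 0`.  With this, N16's share of `stub_rates13H`'s witness reads off THE DAG's OWN NODE STATEMENTS: N05's edge at the pinned members (`h5`) and N07's K1 leaf of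
record (`h07`), plus the one located dictionary row (the transfer); `…_n19rows` twin included.

HONEST FRAMING.  Kernel bookkeeping by name; no estimate; `h5`, `h07 : B11Leaf (Z11OfRecord F N ζ)` ([Balaban1985Variational] Thm 1 at NODE 00's (0.4)-objects — node N07's content)
and the transfer (NOT in print as a theorem; a located hypothesis shape) are DISPLAYED, asserted for no family; nothing of Bałaban asserted; no stub closed; N16 ∕ N07 ∕ N19 NOT
discharged; the skeleton of record is the planner's and is NOT edited; counts UNMOVED (typed 28∕28 · discharged 5∕27, A 5∕28); one finite four-torus at fixed ε — NOT ℝ⁴ ∕ infinite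
volume ∕ OS ∕ mass gap ∕ Clay.
-/

set_option autoImplicit false

open scoped BigOperators Matrix Matrix.Norms.L2Operator
open NormedSpace

namespace Summit.QuantumFields.YangMills.BalabanUVNodes.N16PinnedLooseMatchOfN07Slot

open Literature.MathematicalPhysics.QuantumFieldTheory.Balaban1983to89
open Literature.MathematicalPhysics.QuantumFieldTheory.Balaban1983to89.T4Continuum (T4Family ULoop)
open B7Prop1Explicit B7Prop2Explicit MatrixLog UnitaryModel
open T4AveragingDeficitWall hiding Site Plaq Bond
open B7Prop3Flat (c3)
open B8LeafModelZd (ZdIdx)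
open B8LeafModelZd3 (zdGF3)
open Node00 (Stage13HParams NE3Objects₁₁ NE3Letters₁₁ ne3ConstLayerOfRecord₁₁ ne3NperOfRecord₁₁ ne3DomOfRecord₁₁ MatA ZIdx ResidZ Z11OfRecord
  exists_thm1At_of_b11Leaf_Z11OfRecord)
open Summit.QuantumFields.BalabanUV.T4Continuum
open MinimalActionRate (sfClass)
open MinimalActionRefine (gradConst)
open MinimalActionDictionary (torusVP RadiiMono)
open AveragingDeficitLatticeH2Prep (fd)
open B11Thm1 (Thm1At)
open DagBinding (B11Leaf)
open YMDAG.UVSplit (NE3Carriers ne3OfRecord₁₁ RateReading₁₃CoPH rateCarriersOfRecord₁₃CoPH)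
open Summit.QuantumFields.YangMills.BalabanUVNodes.N16HolderDefs (N16HolderAt)
open Summit.QuantumFields.YangMills.BalabanUVNodes.N16PinnedLayer13CoPH (N16PinnedLoose N16LettersEnd N16HolderAtReading)
open Summit.QuantumFields.YangMills.BalabanUVNodes.N16H7OfN07RecordSlot (lipGauge radiiMono_lipGauge' interface_lipGauge' Thm1AtTransfer04to42)
open Summit.QuantumFields.YangMills.BalabanUVNodes.N16PinnedLooseMatch (exists_letters_n16HolderAtReading_loose_of_h5_thm1At_match
  exists_letters_n16HolderAtReading_loose_of_h5_thm1At_match_n19rows)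

noncomputable section

variable {N : ℕ} [NeZero N] {β : ℝ} (hβ0 : 0 ≤ β) (hβ1 : β ≤ 1)
include hβ0 hβ1

/-- **★ THE N07 → N16 EDGE BY NAME AT NODE N07's RECORD SLOT — v5's THREE N16 CONJUNCTS.**  Node N05's `h5` (37ᴴ's, VERBATIM), `g F > 0`, and per family node N07's K1-side leaf of
record `B11Leaf (Z11OfRecord F N ζ)` together with dag-n16-w1's displayed (0.4)→(42) transfer `Thm1AtTransfer04to42 F N ζ B₀` (any letter `B₀`) give letters `ℓ₃` and a
radius letter `B` with THE END's rows `N16LettersEnd N g ℓ₃`, the MATCH row `∀ F, 0 < B F ∧ (ℓ₃ F).ε ∕ B F ≤ (ℓ₃ F).b` (= `N16RadiusMatch ℓ₃ B`), and the N16 conjunct at EVERY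
reading pinned LOOSE at `ℓ₃, B`.  Proof: `exists_thm1At_of_b11Leaf_Z11OfRecord` ∘ the transfer give the Theorem-1 reading at `torusVP … (lipGauge 4 (Fin N)) (k+1)` with its
`M`-bound; module 45 at `G := lipGauge` (interface `radiiMono_lipGauge'` ∕ `interface_lipGauge'`). [cite: Balaban1985Variational, Thm 1 (8)–(10) p.279] [folklore] -/
theorem exists_letters_n16HolderAtReading_loose_of_h5_b11Leaf_transfer_match {g : T4Family → ℝ} (hg : ∀ F, 0 < g F)
    (h5 : ∀ F : T4Family, letI : CStarAlgebra (Matrix (Fin N) (Fin N) ℂ) := {}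
      ∃ (len : Site 4 → ℝ) (c₁ c₁' B₁' cP C₂ B₀β : ℝ) (inp : B8.B9Inputs),
        (∀ v : Site 4, 0 < len v → 1 ≤ len v) ∧ (∀ μ : Fin 4, len (e μ) = 1) ∧ 0 < B₁' ∧ 5 * ((4 : ℕ) : ℝ) * F.L * inp.B₀ ≤ B₁' ∧ 0 < c₁' ∧
        (∀ α₀ α₁ : ℝ, 0 < α₀ → 0 < α₁ → α₀ + α₁ ≤ c₁' →
          α₀ + α₁ ≤ c₁ ∧ C0 4 * (2 * α₀) ≤ 1 / 3 ∧ 4 * α₀ ≤ c2' 4 F.L ∧ 16 * (B₁' * (α₀ + α₁)) ≤ 1 ∧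
          Real.exp (4 * (800 * (((4 : ℕ) : ℝ) + 1) ^ 2 * (((4 : ℕ) : ℝ) + 4)) * α₀) * (1 + 8 * (131072 * (((4 : ℕ) : ℝ) + 1) ^ 2) * (B₁' * (α₀ + α₁))) ≤ 2 ∧
          2 * (B₁' * (α₀ + α₁)) ≤ c3 4 F.L ∧ ((4 : ℕ) : ℝ) * F.L * α₁ ≤ 1 / 8 ∧ α₀ ≤ cP ∧ α₁ ≤ cP ∧ B₁' * (α₀ + α₁) ≤ cP ∧
          2 * (B₁' * (α₀ + α₁)) ^ 2 + 20 * ((4 : ℕ) : ℝ) * α₀ * (B₁' * (α₀ + α₁)) + 2 * C₂ * (B₁' * (α₀ + α₁)) ^ 2 ≤ α₀ + α₁) ∧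
        B8.Thm4Body c₁ B₁' (fun i : {i : ZdIdx 4 F.L // (∀ j, i.Ω j = Set.univ) ∧ (∀ m j, i.Λs m j = {_y | j = m}) ∧ (∀ m j, i.Λb m j = {_c | j = m}) ∧ i.η = ((F.L : ℝ)⁻¹) ^ i.k} => (zdGF3 (Matrix (Fin N) (Fin N) ℂ) F.L β len i.1).toGFData) ∧
        B8.Prop3Body cP 4 (F.L : ℝ) C₂ inp B₀β (fun i : {i : ZdIdx 4 F.L // (∀ j, i.Ω j = Set.univ) ∧ (∀ m j, i.Λs m j = {_y | j = m}) ∧ (∀ m j, i.Λb m j = {_c | j = m}) ∧ i.η = ((F.L : ℝ)⁻¹) ^ i.k} => (zdGF3 (Matrix (Fin N) (Fin N) ℂ) F.L β len i.1).toGFData2))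
    (h07 : ∀ F : T4Family, ∃ (ζ : ResidZ F N) (B₀ : ℝ), B11Leaf (Z11OfRecord F N ζ) ∧ Thm1AtTransfer04to42 F N ζ B₀) :
    ∃ (ℓ₃ : T4Family → NE3Letters₁₁) (B : T4Family → ℝ), N16LettersEnd N g ℓ₃ ∧
      (∀ F : T4Family, 0 < B F ∧ (ℓ₃ F).ε / B F ≤ (ℓ₃ F).b) ∧
      ∀ 𝔯 : RateReading₁₃CoPH N, N16PinnedLoose 𝔯 ℓ₃ B → N16HolderAtReading 𝔯 β := by
  -- per family: node N07's slot ⟹ Theorem 1 at NODE 00's (0.4)-objects ⟹ (transfer) Theorem 1 at leaf-06's (42)-torus instances in the `lipGauge` shape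
  choose ζ B₀ h07' hT using h07
  choose C' hC' using fun F => hT F (exists_thm1At_of_b11Leaf_Z11OfRecord (h07' F))
  obtain ⟨ℓ₃, B, hL, hM, -, hH⟩ := exists_letters_n16HolderAtReading_loose_of_h5_thm1At_match (N := N) hβ0 hβ1 hg h5
    (G := fun _ => lipGauge 4 (Fin N)) (fun _ => radiiMono_lipGauge')
    (fun _ U x K α₀ α₁ α₂ hK hGU => interface_lipGauge' U x K α₀ α₁ α₂ hK hGU) C' (fun F => (hC' F).2.1) (fun F => (hC' F).2.2)
  exact ⟨ℓ₃, B, hL, hM, hH⟩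

/-- **★ THE SAME WITH NODE N19's TWO FURTHER RADIUS GUARDS** (`ε∕B ≤ 1∕4`, `4·(ε∕B) ≤ c'` with `gradConst 4 c' = g F`) — module 45's `…_match_n19rows` at the record-slot inputs;
typed ahead for (t-N16b). [cite: Balaban1985Variational, Thm 1 (8)–(10) p.279] [folklore] -/
theorem exists_letters_n16HolderAtReading_loose_of_h5_b11Leaf_transfer_match_n19rows {g : T4Family → ℝ} (hg : ∀ F, 0 < g F)
    (h5 : ∀ F : T4Family, letI : CStarAlgebra (Matrix (Fin N) (Fin N) ℂ) := {}
      ∃ (len : Site 4 → ℝ) (c₁ c₁' B₁' cP C₂ B₀β : ℝ) (inp : B8.B9Inputs),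
        (∀ v : Site 4, 0 < len v → 1 ≤ len v) ∧ (∀ μ : Fin 4, len (e μ) = 1) ∧ 0 < B₁' ∧ 5 * ((4 : ℕ) : ℝ) * F.L * inp.B₀ ≤ B₁' ∧ 0 < c₁' ∧
        (∀ α₀ α₁ : ℝ, 0 < α₀ → 0 < α₁ → α₀ + α₁ ≤ c₁' →
          α₀ + α₁ ≤ c₁ ∧ C0 4 * (2 * α₀) ≤ 1 / 3 ∧ 4 * α₀ ≤ c2' 4 F.L ∧ 16 * (B₁' * (α₀ + α₁)) ≤ 1 ∧
          Real.exp (4 * (800 * (((4 : ℕ) : ℝ) + 1) ^ 2 * (((4 : ℕ) : ℝ) + 4)) * α₀) * (1 + 8 * (131072 * (((4 : ℕ) : ℝ) + 1) ^ 2) * (B₁' * (α₀ + α₁))) ≤ 2 ∧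
          2 * (B₁' * (α₀ + α₁)) ≤ c3 4 F.L ∧ ((4 : ℕ) : ℝ) * F.L * α₁ ≤ 1 / 8 ∧ α₀ ≤ cP ∧ α₁ ≤ cP ∧ B₁' * (α₀ + α₁) ≤ cP ∧
          2 * (B₁' * (α₀ + α₁)) ^ 2 + 20 * ((4 : ℕ) : ℝ) * α₀ * (B₁' * (α₀ + α₁)) + 2 * C₂ * (B₁' * (α₀ + α₁)) ^ 2 ≤ α₀ + α₁) ∧
        B8.Thm4Body c₁ B₁' (fun i : {i : ZdIdx 4 F.L // (∀ j, i.Ω j = Set.univ) ∧ (∀ m j, i.Λs m j = {_y | j = m}) ∧ (∀ m j, i.Λb m j = {_c | j = m}) ∧ i.η = ((F.L : ℝ)⁻¹) ^ i.k} => (zdGF3 (Matrix (Fin N) (Fin N) ℂ) F.L β len i.1).toGFData) ∧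
        B8.Prop3Body cP 4 (F.L : ℝ) C₂ inp B₀β (fun i : {i : ZdIdx 4 F.L // (∀ j, i.Ω j = Set.univ) ∧ (∀ m j, i.Λs m j = {_y | j = m}) ∧ (∀ m j, i.Λb m j = {_c | j = m}) ∧ i.η = ((F.L : ℝ)⁻¹) ^ i.k} => (zdGF3 (Matrix (Fin N) (Fin N) ℂ) F.L β len i.1).toGFData2))
    (h07 : ∀ F : T4Family, ∃ (ζ : ResidZ F N) (B₀ : ℝ), B11Leaf (Z11OfRecord F N ζ) ∧ Thm1AtTransfer04to42 F N ζ B₀) :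
    ∃ (ℓ₃ : T4Family → NE3Letters₁₁) (B : T4Family → ℝ) (c' : T4Family → ℝ), N16LettersEnd N g ℓ₃ ∧
      (∀ F : T4Family, 0 < B F ∧ (ℓ₃ F).ε / B F ≤ (ℓ₃ F).b) ∧
      (∀ F : T4Family, 0 < c' F ∧ gradConst 4 (c' F) = g F ∧ (ℓ₃ F).ε / B F ≤ 1 / 4 ∧ 4 * ((ℓ₃ F).ε / B F) ≤ c' F) ∧
      ∀ 𝔯 : RateReading₁₃CoPH N, N16PinnedLoose 𝔯 ℓ₃ B → N16HolderAtReading 𝔯 β := by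
  choose ζ B₀ h07' hT using h07
  choose C' hC' using fun F => hT F (exists_thm1At_of_b11Leaf_Z11OfRecord (h07' F))
  obtain ⟨ℓ₃, B, c', hL, hM, -, hrows, hH⟩ := exists_letters_n16HolderAtReading_loose_of_h5_thm1At_match_n19rows (N := N) hβ0 hβ1 hg h5
    (G := fun _ => lipGauge 4 (Fin N)) (fun _ => radiiMono_lipGauge')
    (fun _ U x K α₀ α₁ α₂ hK hGU => interface_lipGauge' U x K α₀ α₁ α₂ hK hGU) C' (fun F => (hC' F).2.1) (fun F => (hC' F).2.2)
  exact ⟨ℓ₃, B, c', hL, hM, hrows, hH⟩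

end

end Summit.QuantumFields.YangMills.BalabanUVNodes.N16PinnedLooseMatchOfN07Slot
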